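import Mathlib
import HarnessLib
import Summits.Ventures.LatticeQCDFlow.Scoring.SampleACFSumZero
import Summits.Ventures.LatticeQCDFlow.Exactness.NCMCGeneralSpaceLagSumVariance

/-!
# Scorer A's autocovariance estimate `Γ̂_N(t)` along a chain with a Doeblin POWER is `L²`-consistent from ANY start: `E_{μ₀}[(Γ̂_N(t) − C_f̄(t))²] ≤ C⁴ (2112 + 1024 t + 4224 m/ε + 512 (m/ε)²)/N` for `2t ≤ N`

HONEST FRAMING: exact (Metropolis-corrected) sampling algorithms for lattice gauge theory;
figures of merit are autocorrelation/cost numbers at stated couplings and volumes; no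
continuum-physics claim.

Venture `LatticeQCDFlow` (cell pub-lqcd), topic `Exactness`; FANOUT row 13 (`eng-snf`, GEN-20).
NEW WORK of the cell, not a published result; no definition is introduced; nothing is cited as a
fact (the effect of sample-mean centring on empirical autocovariances — Anderson 1971 Ch. 8;
Priestley 1981 §5.3 — NAMED ONLY).  THE OBJECT IS THE FROZEN SCORER'S: row 11 typed scorer A 0.1.2's
Γ-method statistics verbatim (`Scoring/SampleACFSumZero.lean`: `sampleMean`, `dev`, the lag sums
`acovSum x N t = Σ_{i<N−t} (xᵢ − x̄)(x_{i+t} − x̄)`, `gammaHat x N t = acovSum/(N − t)` = `gamma_function`,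
`rhoHat`, `tauIntWindow ρ̂ W` = `tau_int_W`).  Along the path `X` of a Markov chain with invariant law `π`
and an `m`-step Doeblin minorisation `(nHit κ m)(x, ·) ≥ ε ν` (`0 < ε ≤ 1`, `0 < m`, `e = ε.toReal`), for
a bounded measurable observable `f` (`|f| ≤ C`, `f̄ = f − πf`, `C_f̄(t) = Scoring.autocov κ π f̄ t` the
stationary autocovariance), the series scored is `i ↦ f(X_i)`.  §1 is pure algebra on a path: with
`δ = x̄_N − πf = (1/N) Σ_{i<N} f̄(X_i)`, `acovSum = S⁰(t) − δ Σ_{i<N−t} (f̄(X_i) + f̄(X_{i+t})) + (N − t) δ²`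
(`S⁰(t) = Σ_{i<N−t} f̄(X_i) f̄(X_{i+t})` the known-mean lag sum), the middle sum is `2Nδ` up to `2t`
boundary terms, hence `|Γ̂_N(t) − S⁰(t)/(N − t)| ≤ 5 · 2C · |δ|` whenever `2t ≤ N`.  §2 adds the chain:
`E_{μ₀} δ² ≤ (2C)² (2 + 4m/e)/N` (`NCMCGeneralSpaceLagProductMoments.chain_sq_sum_centred_le_of_nHit`) and
the known-mean mean-square error `E_{μ₀}[(S⁰(t)/(N − t) − C_f̄(t))²] ≤ 8 (2C)⁴ (1 + 2t + 2m/e + (m/e)²)/(N − t)`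
(`NCMCGeneralSpaceLagSumVariance.chain_mse_lagSum_div_le_of_nHit`) give THE MEAN-SQUARE ERROR OF THE
SCORER'S `Γ̂_N(t)` ABOUT THE STATIONARY AUTOCOVARIANCE, of order `(t + 1)/N` UNIFORMLY IN THE INITIAL LAW
(no thermalisation cut, no stationarity assumed).  The windowed sum and `τ̂_W` are
`NCMCGeneralSpaceGammaMethodConsistency.lean`.

## Content

§1 (any `f`, any constant `c`, any path; `y = f ∘ x`, `δ = sampleMean y N − c`)
* `acovSum_comp_eq` — `acovSum y N t = Σ_{i<N−t} (f(x_i) − c)(f(x_{i+t}) − c)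
  − δ Σ_{i<N−t} ((f(x_i) − c) + (f(x_{i+t}) − c)) + (N − t) δ²`;
* `sampleMean_sub_eq` — `δ = (Σ_{i<N} (f(x_i) − c))/N` (`N ≠ 0`); `abs_sampleMean_sub_le` (`|δ| ≤ C_b` if
  `|f − c| ≤ C_b`);
* `abs_sum_pair_sub_two_mul_le` — `|Σ_{i<N−t} ((f(x_i) − c) + (f(x_{i+t}) − c)) − 2 Σ_{i<N} (f(x_i) − c)| ≤ 2 t C_b`
  (`t ≤ N`);
* **`abs_gammaHat_sub_lagSum_div_le`** — `|gammaHat y N t − S⁰(t)/(N − t)| ≤ 5 C_b |δ|` (`2t ≤ N`, `0 < N`);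
  `sq_gammaHat_sub_le` — `(gammaHat y N t − a)² ≤ 2 (S⁰(t)/(N − t) − a)² + 2 (5 C_b)² δ²`;
* `measurable_gammaHat_comp`, `abs_gammaHat_comp_le` (`|Γ̂_N(t)| ≤ (2C)²`).
§2 (the chain, every `μ₀`)
* `integral_sq_sub_le_of_pointwise` (integration of the pointwise splitting);
* **`chain_sq_sampleMean_sub_le_of_nHit`** — `E_{μ₀}[(x̄_N − πf)²] ≤ (2C)² (2 + 4m/e)/N`;
* **`chain_mse_gammaHat_le_of_nHit`** — for `2t ≤ N`, `0 < N`: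
  `E_{μ₀}[(gammaHat (f ∘ X) N t − C_f̄(t))²] ≤ C⁴ (2112 + 1024 t + 4224 m/e + 512 (m/e)²)/N`.

NOT CLAIMED: sharp constants (the scorer's `t ≤ W ≪ N` regime only: `2t ≤ N`); the bias-corrected or
replica-pooled variants of the Γ-method; unbounded observables; any `ε` of a concrete sampler.
-/

namespace Summit.Ventures.LatticeQCDFlow.Exactness.GeneralNCMC

open MeasureTheory ProbabilityTheory Set Filter Finset
open scoped ENNReal Topology

variable {S : Type*} [MeasurableSpace S]

/-! ## §1 Algebra of sample-mean centring on a path -/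

section Path

omit [MeasurableSpace S] in
/-- **Sample-mean centring versus a fixed centre**: with `y = f ∘ x` and `δ = sampleMean y N − c`,
`acovSum y N t = Σ_{i<N−t} (f(x_i) − c)(f(x_{i+t}) − c) − δ Σ_{i<N−t} ((f(x_i) − c) + (f(x_{i+t}) − c))
+ (N − t) δ²`. -/
theorem acovSum_comp_eq (f : S → ℝ) (c : ℝ) (x : ℕ → S) (N t : ℕ) :
    Scoring.acovSum (fun i => f (x i)) N t
      = ∑ i ∈ range (N - t), (f (x i) - c) * (f (x (i + t)) - c)
        - (Scoring.sampleMean (fun i => f (x i)) N - c)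
          * ∑ i ∈ range (N - t), ((f (x i) - c) + (f (x (i + t)) - c))
        + ((N - t : ℕ) : ℝ) * (Scoring.sampleMean (fun i => f (x i)) N - c) ^ 2 := by
  unfold Scoring.acovSum Scoring.lagSum Scoring.dev
  set δ := Scoring.sampleMean (fun i => f (x i)) N - c with hδ
  have hpt : ∀ i ∈ range (N - t),
      (f (x i) - Scoring.sampleMean (fun i => f (x i)) N)
        * (f (x (i + t)) - Scoring.sampleMean (fun i => f (x i)) N)
      = (f (x i) - c) * (f (x (i + t)) - c) - δ * ((f (x i) - c) + (f (x (i + t)) - c)) + δ ^ 2 := by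
    intro i _; rw [hδ]; ring
  rw [Finset.sum_congr rfl hpt, Finset.sum_add_distrib, Finset.sum_sub_distrib, ← Finset.mul_sum,
    Finset.sum_const, Finset.card_range, nsmul_eq_mul]

omit [MeasurableSpace S] in
/-- `sampleMean (f ∘ x) N − c = (Σ_{i<N} (f(x_i) − c))/N` (`N ≠ 0`). -/
theorem sampleMean_sub_eq (f : S → ℝ) (c : ℝ) (x : ℕ → S) {N : ℕ} (hN : N ≠ 0) :
    Scoring.sampleMean (fun i => f (x i)) N - c = (∑ i ∈ range N, (f (x i) - c)) / N := by
  have hN' : (N : ℝ) ≠ 0 := by exact_mod_cast hN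
  unfold Scoring.sampleMean
  rw [Finset.sum_sub_distrib, Finset.sum_const, Finset.card_range, nsmul_eq_mul]
  field_simp

omit [MeasurableSpace S] in
/-- `|sampleMean (f ∘ x) N − c| ≤ C_b` when `|f − c| ≤ C_b` (`N ≠ 0`). -/
theorem abs_sampleMean_sub_le (f : S → ℝ) (c : ℝ) (x : ℕ → S) {N : ℕ} (hN : N ≠ 0) {Cb : ℝ}
    (hCb : ∀ y, |f y - c| ≤ Cb) :
    |Scoring.sampleMean (fun i => f (x i)) N - c| ≤ Cb := by
  have hN' : (0 : ℝ) < N := by exact_mod_cast Nat.pos_of_ne_zero hN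
  rw [sampleMean_sub_eq f c x hN, abs_div, abs_of_pos hN', div_le_iff₀ hN']
  calc |∑ i ∈ range N, (f (x i) - c)| ≤ ∑ i ∈ range N, |f (x i) - c| := Finset.abs_sum_le_sum_abs _ _
    _ ≤ ∑ i ∈ range N, Cb := Finset.sum_le_sum fun i _ => hCb _
    _ = Cb * N := by rw [Finset.sum_const, Finset.card_range, nsmul_eq_mul, mul_comm]

omit [MeasurableSpace S] in
/-- **The boundary terms**: for `t ≤ N` and `|f − c| ≤ C_b`,
`|Σ_{i<N−t} ((f(x_i) − c) + (f(x_{i+t}) − c)) − 2 Σ_{i<N} (f(x_i) − c)| ≤ 2 t C_b`. -/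
theorem abs_sum_pair_sub_two_mul_le (f : S → ℝ) (c : ℝ) (x : ℕ → S) {N t : ℕ} (htN : t ≤ N)
    {Cb : ℝ} (hCb : ∀ y, |f y - c| ≤ Cb) :
    |∑ i ∈ range (N - t), ((f (x i) - c) + (f (x (i + t)) - c))
        - 2 * ∑ i ∈ range N, (f (x i) - c)| ≤ 2 * t * Cb := by
  -- split the full sum at `N − t` and at `t`
  have h1 : ∑ i ∈ range N, (f (x i) - c)
      = ∑ i ∈ range (N - t), (f (x i) - c) + ∑ j ∈ range t, (f (x (N - t + j)) - c) := by
    conv_lhs => rw [show N = (N - t) + t by omega]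
    rw [Finset.sum_range_add]
  have h2 : ∑ i ∈ range N, (f (x i) - c)
      = ∑ j ∈ range t, (f (x j) - c) + ∑ i ∈ range (N - t), (f (x (i + t)) - c) := by
    conv_lhs => rw [show N = t + (N - t) by omega]
    rw [Finset.sum_range_add]
    congr 1
    exact Finset.sum_congr rfl fun i _ => by rw [add_comm]
  have hsplit : ∑ i ∈ range (N - t), ((f (x i) - c) + (f (x (i + t)) - c))
        - 2 * ∑ i ∈ range N, (f (x i) - c)
      = -(∑ j ∈ range t, (f (x (N - t + j)) - c) + ∑ j ∈ range t, (f (x j) - c)) := by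
    rw [Finset.sum_add_distrib]
    linarith [h1, h2]
  rw [hsplit, abs_neg]
  calc |∑ j ∈ range t, (f (x (N - t + j)) - c) + ∑ j ∈ range t, (f (x j) - c)|
      ≤ |∑ j ∈ range t, (f (x (N - t + j)) - c)| + |∑ j ∈ range t, (f (x j) - c)| := abs_add_le _ _
    _ ≤ ∑ j ∈ range t, |f (x (N - t + j)) - c| + ∑ j ∈ range t, |f (x j) - c| :=
        add_le_add (Finset.abs_sum_le_sum_abs _ _) (Finset.abs_sum_le_sum_abs _ _)
    _ ≤ ∑ j ∈ range t, Cb + ∑ j ∈ range t, Cb :=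
        add_le_add (Finset.sum_le_sum fun j _ => hCb _) (Finset.sum_le_sum fun j _ => hCb _)
    _ = 2 * t * Cb := by rw [Finset.sum_const, Finset.card_range, nsmul_eq_mul]; ring

omit [MeasurableSpace S] in
/-- **THE CENTRING ERROR OF SCORER A's `Γ̂`**: for `2t ≤ N`, `0 < N` and `|f − c| ≤ C_b`, with
`δ = sampleMean (f ∘ x) N − c` and `S⁰(t) = Σ_{i<N−t} (f(x_i) − c)(f(x_{i+t}) − c)`:
`|gammaHat (f ∘ x) N t − S⁰(t)/(N − t)| ≤ 5 C_b |δ|`. -/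
theorem abs_gammaHat_sub_lagSum_div_le (f : S → ℝ) (c : ℝ) (x : ℕ → S) {N t : ℕ} (htN : 2 * t ≤ N)
    (hN : 0 < N) {Cb : ℝ} (hCb : ∀ y, |f y - c| ≤ Cb) :
    |Scoring.gammaHat (fun i => f (x i)) N t
        - (∑ i ∈ range (N - t), (f (x i) - c) * (f (x (i + t)) - c)) / ((N - t : ℕ) : ℝ)|
      ≤ 5 * Cb * |Scoring.sampleMean (fun i => f (x i)) N - c| := by
  set δ := Scoring.sampleMean (fun i => f (x i)) N - c with hδ
  have hCb0 : 0 ≤ Cb := (abs_nonneg _).trans (hCb (x 0))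
  have hNt : (0 : ℝ) < ((N - t : ℕ) : ℝ) := by exact_mod_cast (show 0 < N - t by omega)
  have hδb : |δ| ≤ Cb := abs_sampleMean_sub_le f c x hN.ne' hCb
  have hT : (N : ℝ) * δ = ∑ i ∈ range N, (f (x i) - c) := by
    rw [hδ, sampleMean_sub_eq f c x hN.ne']
    field_simp
  have hR := abs_sum_pair_sub_two_mul_le f c x (show t ≤ N by omega) hCb
  rw [← hT] at hR
  set R := ∑ i ∈ range (N - t), ((f (x i) - c) + (f (x (i + t)) - c)) - 2 * ((N : ℝ) * δ) with hRdef
  unfold Scoring.gammaHat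
  rw [acovSum_comp_eq f c x N t, ← hδ, ← sub_div,
    show ∑ i ∈ range (N - t), (f (x i) - c) * (f (x (i + t)) - c)
        - δ * ∑ i ∈ range (N - t), ((f (x i) - c) + (f (x (i + t)) - c))
        + ((N - t : ℕ) : ℝ) * δ ^ 2 - ∑ i ∈ range (N - t), (f (x i) - c) * (f (x (i + t)) - c)
      = ((N - t : ℕ) : ℝ) * δ ^ 2 - δ * (R + 2 * ((N : ℝ) * δ)) by rw [hRdef]; ring,
    abs_div, abs_of_pos hNt, div_le_iff₀ hNt]
  have hcast : ((N - t : ℕ) : ℝ) = (N : ℝ) - t := by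
    rw [Nat.cast_sub (by omega)]
  rw [hcast] at hNt ⊢
  have ht2 : 2 * (t : ℝ) ≤ N := by exact_mod_cast htN
  -- `|(N−t)δ² − δ(R + 2Nδ)| = |−(N+t)δ² − δR| ≤ (N+t)δ² + |δ| 2tC_b ≤ C_b|δ|(N + 3t) ≤ 5C_b|δ|(N−t)`
  have hδ2 : δ ^ 2 ≤ Cb * |δ| := by
    calc δ ^ 2 = |δ| * |δ| := by rw [← sq_abs, sq]
      _ ≤ Cb * |δ| := mul_le_mul_of_nonneg_right hδb (abs_nonneg _)
  calc |((N : ℝ) - t) * δ ^ 2 - δ * (R + 2 * ((N : ℝ) * δ))|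
      = |-(((N : ℝ) + t) * δ ^ 2) - δ * R| := by ring_nf
    _ ≤ |-(((N : ℝ) + t) * δ ^ 2)| + |δ * R| := abs_sub _ _
    _ = ((N : ℝ) + t) * δ ^ 2 + |δ| * |R| := by
        rw [abs_neg, abs_of_nonneg (by positivity : (0 : ℝ) ≤ ((N : ℝ) + t) * δ ^ 2), abs_mul δ R]
    _ ≤ ((N : ℝ) + t) * (Cb * |δ|) + |δ| * (2 * t * Cb) :=
        add_le_add (mul_le_mul_of_nonneg_left hδ2 (by positivity))
          (mul_le_mul_of_nonneg_left hR (abs_nonneg _))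
    _ = Cb * |δ| * ((N : ℝ) + 3 * t) := by ring
    _ ≤ Cb * |δ| * (5 * ((N : ℝ) - t)) :=
        mul_le_mul_of_nonneg_left (by linarith) (mul_nonneg hCb0 (abs_nonneg _))
    _ = 5 * Cb * |δ| * ((N : ℝ) - t) := by ring

omit [MeasurableSpace S] in
/-- Squared form: `(Γ̂_N(t) − a)² ≤ 2 (S⁰(t)/(N − t) − a)² + 2 (5 C_b)² δ²` for every `a`. -/
theorem sq_gammaHat_sub_le (f : S → ℝ) (c : ℝ) (x : ℕ → S) {N t : ℕ} (htN : 2 * t ≤ N)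
    (hN : 0 < N) {Cb : ℝ} (hCb : ∀ y, |f y - c| ≤ Cb) (a : ℝ) :
    (Scoring.gammaHat (fun i => f (x i)) N t - a) ^ 2
      ≤ 2 * ((∑ i ∈ range (N - t), (f (x i) - c) * (f (x (i + t)) - c)) / ((N - t : ℕ) : ℝ) - a) ^ 2
        + 2 * ((5 * Cb) ^ 2 * (Scoring.sampleMean (fun i => f (x i)) N - c) ^ 2) := by
  have h := abs_gammaHat_sub_lagSum_div_le f c x htN hN hCb
  have h2 := pow_le_pow_left₀ (abs_nonneg _) h 2
  rw [sq_abs, mul_pow, sq_abs] at h2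
  nlinarith [h2, sq_nonneg (Scoring.gammaHat (fun i => f (x i)) N t
    - (∑ i ∈ range (N - t), (f (x i) - c) * (f (x (i + t)) - c)) / ((N - t : ℕ) : ℝ)
    - ((∑ i ∈ range (N - t), (f (x i) - c) * (f (x (i + t)) - c)) / ((N - t : ℕ) : ℝ) - a))]

/-- The scorer's `Γ̂_N(t)` of `f ∘ X` is a measurable function of the path. -/
theorem measurable_gammaHat_comp {f : S → ℝ} (hf : Measurable f) (N t : ℕ) :
    Measurable fun x : ℕ → S => Scoring.gammaHat (fun i => f (x i)) N t := by
  unfold Scoring.gammaHat Scoring.acovSum Scoring.lagSum Scoring.dev Scoring.sampleMean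
  have hm : Measurable fun x : ℕ → S => (∑ i ∈ range N, f (x i)) / (N : ℝ) :=
    (Finset.measurable_sum _ fun i _ => hf.comp (measurable_pi_apply i)).div_const _
  refine (Finset.measurable_sum _ fun i _ => ?_).div_const _
  exact ((hf.comp (measurable_pi_apply i)).sub hm).mul ((hf.comp (measurable_pi_apply _)).sub hm)

omit [MeasurableSpace S] in
/-- `|Γ̂_N(t)| ≤ (2C)²` along any path when `|f| ≤ C`. -/
theorem abs_gammaHat_comp_le {f : S → ℝ} {C : ℝ} (hC : ∀ y, |f y| ≤ C) (x : ℕ → S) (N t : ℕ) :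
    |Scoring.gammaHat (fun i => f (x i)) N t| ≤ (2 * C) ^ 2 := by
  have hC0 : 0 ≤ C := (abs_nonneg _).trans (hC (x 0))
  unfold Scoring.gammaHat Scoring.acovSum Scoring.lagSum Scoring.dev
  -- each deviation is at most `2C`
  have hmean : |Scoring.sampleMean (fun i => f (x i)) N| ≤ C := by
    unfold Scoring.sampleMean
    rcases Nat.eq_zero_or_pos N with hN | hN
    · simp [hN, hC0]
    · have hN' : (0 : ℝ) < N := by exact_mod_cast hN
      rw [abs_div, abs_of_pos hN', div_le_iff₀ hN']
      calc |∑ i ∈ range N, f (x i)| ≤ ∑ i ∈ range N, |f (x i)| := Finset.abs_sum_le_sum_abs _ _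
        _ ≤ ∑ i ∈ range N, C := Finset.sum_le_sum fun i _ => hC _
        _ = C * N := by rw [Finset.sum_const, Finset.card_range, nsmul_eq_mul, mul_comm]
  have hdev : ∀ i, |f (x i) - Scoring.sampleMean (fun i => f (x i)) N| ≤ 2 * C := fun i =>
    (abs_sub _ _).trans (by linarith [hC (x i), hmean])
  rcases Nat.eq_zero_or_pos (N - t) with hNt | hNt
  · rw [hNt]; simp; positivity
  · have hNt' : (0 : ℝ) < ((N - t : ℕ) : ℝ) := by exact_mod_cast hNt
    rw [abs_div, abs_of_pos hNt', div_le_iff₀ hNt']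
    calc |∑ i ∈ range (N - t), (f (x i) - Scoring.sampleMean (fun i => f (x i)) N)
          * (f (x (i + t)) - Scoring.sampleMean (fun i => f (x i)) N)|
        ≤ ∑ i ∈ range (N - t), |(f (x i) - Scoring.sampleMean (fun i => f (x i)) N)
          * (f (x (i + t)) - Scoring.sampleMean (fun i => f (x i)) N)| := Finset.abs_sum_le_sum_abs _ _
      _ ≤ ∑ i ∈ range (N - t), (2 * C) ^ 2 := Finset.sum_le_sum fun i _ => by
          rw [abs_mul, sq]
          exact mul_le_mul (hdev _) (hdev _) (abs_nonneg _) (by positivity)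
      _ = (2 * C) ^ 2 * ((N - t : ℕ) : ℝ) := by
          rw [Finset.sum_const, Finset.card_range, nsmul_eq_mul, mul_comm]

end Path

/-! ## §2 Along the chain: the mean-square error of `Γ̂_N(t)` from any start -/

section Chain

variable {κ : Kernel S S} [IsMarkovKernel κ] {ν : Measure S} [IsProbabilityMeasure ν] {ε : ℝ≥0∞}
  {π : Measure S} [IsProbabilityMeasure π] {m : ℕ} (μ₀ : Measure S) [IsProbabilityMeasure μ₀]

/-- **The sample mean about `πf`, any start**: `E_{μ₀}[(sampleMean (f ∘ X) N − πf)²] ≤ (2C)² (2 + 4m/ε)/N`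
(`0 < N`). -/
theorem chain_sq_sampleMean_sub_le_of_nHit
    (hmin : ∀ x {B : Set S}, MeasurableSet B → ε * ν B ≤ nHit κ m x B) (hε0 : 0 < ε) (hε1 : ε ≤ 1)
    (hm : 0 < m) (hπ : Kernel.Invariant κ π) {f : S → ℝ} (hf : Measurable f) {C : ℝ}
    (hC : ∀ x, |f x| ≤ C) {N : ℕ} (hN : 0 < N) :
    ∫ x, (Scoring.sampleMean (fun i => f (x i)) N - ∫ z, f z ∂π) ^ 2
        ∂(Kernel.trajMeasure (X := fun _ : ℕ => S) μ₀
        (fun n : ℕ => κ.comap (fun h : (i : ↥(Finset.Iic n)) → S => h ⟨n, Finset.mem_Iic.2 le_rfl⟩)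
          (measurable_pi_apply _)))
      ≤ (2 * C) ^ 2 * (2 + 4 * m / ε.toReal) / N := by
  set P := Kernel.trajMeasure (X := fun _ : ℕ => S) μ₀
      (fun n : ℕ => κ.comap (fun h : (i : ↥(Finset.Iic n)) → S => h ⟨n, Finset.mem_Iic.2 le_rfl⟩)
        (measurable_pi_apply _)) with hP
  have hN' : (0 : ℝ) < N := by exact_mod_cast hN
  have h := chain_sq_sum_centred_le_of_nHit μ₀ hmin hε0 hε1 hm hπ hf hC 0 N
  rw [← hP] at h
  simp only [Nat.zero_add] at h
  have hpt : ∀ x : ℕ → S, (Scoring.sampleMean (fun i => f (x i)) N - ∫ z, f z ∂π) ^ 2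
      = (∑ t ∈ range N, (f (x t) - ∫ z, f z ∂π)) ^ 2 / (N : ℝ) ^ 2 := fun x => by
    rw [sampleMean_sub_eq f _ x hN.ne', div_pow]
  rw [integral_congr_ae (ae_of_all _ hpt), integral_div]
  calc (∫ x, (∑ t ∈ range N, (f (x t) - ∫ z, f z ∂π)) ^ 2 ∂P) / (N : ℝ) ^ 2
      ≤ (2 * C) ^ 2 * (2 + 4 * m / ε.toReal) * N / (N : ℝ) ^ 2 :=
        div_le_div_of_nonneg_right h (by positivity)
    _ = (2 * C) ^ 2 * (2 + 4 * m / ε.toReal) / N := by field_simp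

omit [MeasurableSpace S] in
/-- Integration of the pointwise splitting `(G − a)² ≤ 2 (L − a)² + 2 K D²` for bounded measurable
`G, L, D` against a finite measure. -/
theorem integral_sq_sub_le_of_pointwise {Ω : Type*} [MeasurableSpace Ω] (P : Measure Ω)
    [IsFiniteMeasure P] {G L D : Ω → ℝ} (hL : Measurable L) (hD : Measurable D)
    {BL BD : ℝ} (hBL : ∀ x, |L x| ≤ BL) (hBD : ∀ x, |D x| ≤ BD) (a K : ℝ)
    (hpt : ∀ x, (G x - a) ^ 2 ≤ 2 * (L x - a) ^ 2 + 2 * (K * D x ^ 2)) :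
    ∫ x, (G x - a) ^ 2 ∂P ≤ 2 * ∫ x, (L x - a) ^ 2 ∂P + 2 * (K * ∫ x, D x ^ 2 ∂P) := by
  have hiL : Integrable (fun x => (L x - a) ^ 2) P :=
    Scoring.integrable_of_bounded P ((hL.sub measurable_const).pow_const 2) (C := (BL + |a|) ^ 2)
      fun x => by
        rw [abs_pow]
        exact pow_le_pow_left₀ (abs_nonneg _) ((abs_sub _ _).trans (add_le_add (hBL x) le_rfl)) 2
  have hiD : Integrable (fun x => D x ^ 2) P :=
    Scoring.integrable_of_bounded P (hD.pow_const 2) (C := BD ^ 2) fun x => by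
      rw [abs_pow]; exact pow_le_pow_left₀ (abs_nonneg _) (hBD x) 2
  have hsum : Integrable (fun x => 2 * (L x - a) ^ 2 + 2 * (K * D x ^ 2)) P :=
    (hiL.const_mul 2).add ((hiD.const_mul K).const_mul 2)
  calc ∫ x, (G x - a) ^ 2 ∂P ≤ ∫ x, (2 * (L x - a) ^ 2 + 2 * (K * D x ^ 2)) ∂P :=
        integral_mono_of_nonneg (ae_of_all _ fun x => sq_nonneg _) hsum (ae_of_all _ hpt)
    _ = 2 * ∫ x, (L x - a) ^ 2 ∂P + 2 * (K * ∫ x, D x ^ 2 ∂P) := by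
        rw [integral_add (hiL.const_mul 2) ((hiD.const_mul K).const_mul 2), integral_const_mul,
          integral_const_mul, integral_const_mul]

/-- **THE MEAN-SQUARE ERROR OF SCORER A's `Γ̂_N(t)` ALONG THE CHAIN, FROM ANY START.**  `κ` Markov,
`π` invariant, `(nHit κ m)(x, ·) ≥ ε ν` (`0 < ε ≤ 1`, `0 < m`), `|f| ≤ C` measurable; for every initial
law `μ₀`, every `N > 0` and every lag `t` with `2t ≤ N`:
`E_{μ₀}[(gammaHat (f ∘ X) N t − autocov κ π (f − πf) t)²] ≤ C⁴ (2112 + 1024 t + 4224 m/e + 512 (m/e)²)/N`. -/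
theorem chain_mse_gammaHat_le_of_nHit
    (hmin : ∀ x {B : Set S}, MeasurableSet B → ε * ν B ≤ nHit κ m x B) (hε0 : 0 < ε) (hε1 : ε ≤ 1)
    (hm : 0 < m) (hπ : Kernel.Invariant κ π) {f : S → ℝ} (hf : Measurable f) {C : ℝ}
    (hC : ∀ x, |f x| ≤ C) {N t : ℕ} (htN : 2 * t ≤ N) (hN : 0 < N) :
    ∫ x, (Scoring.gammaHat (fun i => f (x i)) N t
        - Scoring.autocov κ π (fun y => f y - ∫ z, f z ∂π) t) ^ 2
        ∂(Kernel.trajMeasure (X := fun _ : ℕ => S) μ₀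
        (fun n : ℕ => κ.comap (fun h : (i : ↥(Finset.Iic n)) → S => h ⟨n, Finset.mem_Iic.2 le_rfl⟩)
          (measurable_pi_apply _)))
      ≤ C ^ 4 * (2112 + 1024 * t + 4224 * m / ε.toReal + 512 * (m / ε.toReal) ^ 2) / N := by
  set P := Kernel.trajMeasure (X := fun _ : ℕ => S) μ₀
      (fun n : ℕ => κ.comap (fun h : (i : ↥(Finset.Iic n)) → S => h ⟨n, Finset.mem_Iic.2 le_rfl⟩)
        (measurable_pi_apply _)) with hP
  set c := ∫ z, f z ∂π with hc
  obtain ⟨hfb, hCfb, -⟩ := Scoring.centred_observable_bounds π hf hC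
  rw [← hc] at hfb hCfb
  have hC0 : 0 ≤ C := (abs_nonneg _).trans (hC (Classical.choice (nonempty_of_isProbabilityMeasure μ₀)))
  have hN' : (0 : ℝ) < N := by exact_mod_cast hN
  have htN' : t < N := by omega
  have hNt0 : 0 < N - t := by omega
  have hNt : (0 : ℝ) < ((N - t : ℕ) : ℝ) := by exact_mod_cast hNt0
  -- the two halves
  have hA := chain_mse_lagSum_div_le_of_nHit μ₀ hmin hε0 hε1 hm hπ hfb hCfb htN'
  have hB := chain_sq_sampleMean_sub_le_of_nHit μ₀ hmin hε0 hε1 hm hπ hf hC hN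
  rw [← hP] at hA hB
  rw [← hc] at hB
  -- measurability and bounds of the right-hand pieces
  have hLm : Measurable fun x : ℕ → S =>
      (∑ i ∈ range (N - t), (f (x i) - c) * (f (x (i + t)) - c)) / ((N - t : ℕ) : ℝ) :=
    (Finset.measurable_sum _ fun i _ =>
      (hfb.comp (measurable_pi_apply i)).mul (hfb.comp (measurable_pi_apply _))).div_const _
  have hDm : Measurable fun x : ℕ → S => Scoring.sampleMean (fun i => f (x i)) N - c := by
    unfold Scoring.sampleMean
    exact ((Finset.measurable_sum _ fun i _ => hf.comp (measurable_pi_apply i)).div_const _).sub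
      measurable_const
  have hLb : ∀ x : ℕ → S,
      |(∑ i ∈ range (N - t), (f (x i) - c) * (f (x (i + t)) - c)) / ((N - t : ℕ) : ℝ)|
        ≤ (2 * C) * (2 * C) := fun x => by
    rw [abs_div, abs_of_pos hNt, div_le_iff₀ hNt]
    calc |∑ i ∈ range (N - t), (f (x i) - c) * (f (x (i + t)) - c)|
        ≤ ∑ i ∈ range (N - t), |(f (x i) - c) * (f (x (i + t)) - c)| := Finset.abs_sum_le_sum_abs _ _
      _ ≤ ∑ i ∈ range (N - t), (2 * C) * (2 * C) := Finset.sum_le_sum fun i _ => by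
          rw [abs_mul]; exact mul_le_mul (hCfb _) (hCfb _) (abs_nonneg _) (by positivity)
      _ = (2 * C) * (2 * C) * ((N - t : ℕ) : ℝ) := by
          rw [Finset.sum_const, Finset.card_range, nsmul_eq_mul, mul_comm]
  have hDb : ∀ x : ℕ → S, |Scoring.sampleMean (fun i => f (x i)) N - c| ≤ 2 * C := fun x =>
    abs_sampleMean_sub_le f c x hN.ne' hCfb
  have hint := integral_sq_sub_le_of_pointwise P (G := fun x : ℕ → S =>
      Scoring.gammaHat (fun i => f (x i)) N t) hLm hDm hLb hDb
    (Scoring.autocov κ π (fun y => f y - c) t) ((5 * (2 * C)) ^ 2)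
    (fun x => sq_gammaHat_sub_le f c x htN hN hCfb _)
  -- `1/(N − t) ≤ 2/N`
  have hNt2 : (N : ℝ) ≤ 2 * ((N - t : ℕ) : ℝ) := by
    rw [Nat.cast_sub htN'.le]
    have h2 : ((2 * t : ℕ) : ℝ) ≤ (N : ℝ) := by exact_mod_cast htN
    push_cast at h2
    linarith
  set Q := 8 * (2 * C) ^ 4 * (1 + 2 * t + 2 * m / ε.toReal + (m / ε.toReal) ^ 2) with hQdef
  have hQ : 0 ≤ Q := by rw [hQdef]; positivity
  have hdiv : Q / ((N - t : ℕ) : ℝ) ≤ 2 * Q / N := by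
    rw [div_le_div_iff₀ hNt hN']
    calc Q * N ≤ Q * (2 * ((N - t : ℕ) : ℝ)) := mul_le_mul_of_nonneg_left hNt2 hQ
      _ = 2 * Q * ((N - t : ℕ) : ℝ) := by ring
  refine hint.trans ?_
  calc 2 * ∫ x, ((∑ i ∈ range (N - t), (f (x i) - c) * (f (x (i + t)) - c)) / ((N - t : ℕ) : ℝ)
          - Scoring.autocov κ π (fun y => f y - c) t) ^ 2 ∂P
        + 2 * ((5 * (2 * C)) ^ 2 * ∫ x, (Scoring.sampleMean (fun i => f (x i)) N - c) ^ 2 ∂P)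
      ≤ 2 * (2 * Q / N) + 2 * ((5 * (2 * C)) ^ 2 * ((2 * C) ^ 2 * (2 + 4 * m / ε.toReal) / N)) :=
        add_le_add (mul_le_mul_of_nonneg_left (hA.trans hdiv) (by norm_num))
          (mul_le_mul_of_nonneg_left (mul_le_mul_of_nonneg_left hB (by positivity)) (by norm_num))
    _ = C ^ 4 * (2112 + 1024 * t + 4224 * m / ε.toReal + 512 * (m / ε.toReal) ^ 2) / N := by
        rw [hQdef]
        ring

end Chain

end Summit.Ventures.LatticeQCDFlow.Exactness.GeneralNCMC
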